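import Summits.QuantumFields.BalabanUV.T4Continuum.Support.NE4TransferModel
import Summits.QuantumFields.BalabanUV.Beta.GAN24.DirichletExhaustionCoer

/-!
# NE7EtaCovarianceSlot — route #1 of the NE7 crux, hardest stub S1∕L7 (`StepTransferModel.StepScaleShift`): the FLAT
# COVARIANCE SLOT is INHABITED by Bałaban's typed `U = 1` covariance family with the printed-kind rate `θ = L⁻²` — a MODEL
# instance of row NE4's one-step transfer model built from GAN24 road P2's kernel theorem `convC_balaban` (first route-1
# socket instantiated for a Bałaban-typed object)

Cell `pub-balaban`, rung (B)+1 sub-cell t4, lineage `b2b-balaban-t4-ne7-p1` (node U5 = NE7; generation 20 = CRUX PROVER NE7 #1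
under the coordinator ruling «YM REDIRECT» e34b3e0c), crux skeleton `HOME/t4/b2b-balaban-t4-ne7-p1-g20/ROUTE1-NE7.md` v1 §2 (stub S1,
leaf L7) ∕ §5 (G2) «NE7-η, flat C-slot first».  HONEST FRAMING (page 1): FIXED FINITE T⁴, rung (B)+1 = the `ε → 0` limit of unit-scale
averaged expectations, CONDITIONAL on BetaPertH and the nine spine estimates (0/9 proved); NOT infinite volume, NOT a mass gap, NOT
the Clay problem.  NE7 and NE4 are NOT PRINTED in [Balaban1984PropagatorsI]–[Balaban1989LargeFieldII] and NOT proved here.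

WHAT THIS FILE IS — AND IS NOT.  Route #1's marginal stub S1 is node U2's `T4CauchySum.InjectedRate`, produced in kernel by
`NE4TransferResolvent.injectedRate_of_model` from the leaves of an abstract ONE-STEP TRANSFER MODEL `M : NE4TransferModel.StepTransferModel 𝔅 𝔸`
(`Support/NE4TransferModel`, row NE4 road A): L3 `TransferBound`, L4 `ActivityLipschitz`, L5 `CouplingLipschitz`, L6 `Admissible`, **L7
`StepScaleShift b b_r ρ E₀ γ`** («the step one level deeper, fed the same old data, differs by ≤ bρ^k: the η-dependence of the one-step
DATA — covariances `C^{(k)}`, `G_k`, `H₁`, minimisers, O(η²) vertices», NOT PRINTED) + the instance O1 for Bałaban's step (constructed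
by nobody).  The ONE ingredient of L7 that print-KIND mathematics reaches today is the FLAT COVARIANCE SLOT: GAN24 road P2 proved IN
KERNEL, for the cell's ℤ^{d+1} typing of Bałaban's `U = 1` covariance `C^{(k)}(𝟙) = C·(pad(CᵀΔ_kC))_Λ⁻¹·Cᵀ` ([Balaban1985BackgroundPropagators]
(2.156)-shaped; tree `Beta/GAN24/DirichletExhaustionCovariancePad.covPad (elimZ L) (deltaZ L) (IsFreeZ L) Λ`), the (CONV-C) shape
`DirichletExhaustion.ConvC`: k-UNIFORM exponential decay AND the one-step rate `|C^{(k+1)} − C^{(k)}|(p,q) ≤ C₄θ^k e^{−δ₄|p−q|}`,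
`θ = L⁻²` (`DirichletExhaustionCoer.convC_balaban` ∕ `decayCauchy_balaban`, binder row G-an2-4).  This file READS that theorem INTO
route #1's socket: in the Banach space `𝔅 = 𝔸 = (K × K →ᵇ ℝ)` of `e^{δ₄|p−q|}`-WEIGHTED bounded kernels (sup norm) the model
`M` with `N k c a = B k w =` the weighted `C^{(k)}`, `W = 0`, `r = 0` satisfies L3–L7 and `Represents` with explicit constants —
in particular **`M.StepScaleShift C₄ b_r (L²)⁻¹ E₀ γ`** — by (CONV-C)'s two clauses and nothing else (§1 generic from `ConvC`, §2 the
Bałaban-typed instance, §3 `d + 1 = 4`).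
IT IS A MODEL INSTANCE OF THE COVARIANCE SLOT ONLY: `W = 0` switches the history channel off and `r = 0` the β¹ read-out; the true
instance O1 reads `G_k`, `H_k`, the constrained minimisers and the activity (rows NE2∕NE3∕NE5), none of which occurs here.  So this file
does NOT discharge L7 for Bałaban's step, does NOT touch `InjectedRate`'s other inputs (L8 = (CONV-C)'s K-slot∕`hconv`, runs, window),
and is NOT NE4 or NE7.  Value: the FIRST leaf of route #1 inhabited by a Bałaban-TYPED object through a kernel theorem on explicit
lattice operators (count before this file: 0), with the rate `ρ = L⁻²` that S1 needs (`ρ < 1` for `L ≥ 2`); and a template for the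
K-slot (`G_k`, `H_k`) once G-an2-4 lands it in the same `ConvC` shape.  [folklore] bookkeeping (sup-norm of a weighted difference);
no cite tags; nothing printed is asserted; no `def` (the model is an explicit structure term displayed in the statements).
-/

noncomputable section

open BoundedContinuousFunction

namespace Summit.QuantumFields.BalabanUV.T4Continuum.NE7EtaCovarianceSlot

open Literature.MathematicalPhysics.QuantumFieldTheory.Balaban1983to89
open B4Sect5Exhaustion (K)
open Summit.QuantumFields.BalabanUV.Beta.GAN24.DirichletExhaustion (ConvC)
open Summit.QuantumFields.BalabanUV.Beta.GAN24.DirichletExhaustionCovariancePad (covPad)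
open Summit.QuantumFields.BalabanUV.Beta.GAN24.DirichletExhaustionElimZ (elimZ IsFreeZ)
open Summit.QuantumFields.BalabanUV.Beta.GAN24.DirichletExhaustionDeltaZ (deltaZ)
open Summit.QuantumFields.BalabanUV.Beta.GAN24.DirichletExhaustionCoer (decayCauchy_balaban)
open Summit.QuantumFields.BalabanUV.T4Continuum.NE4TransferModel (StepTransferModel)

variable {d N : ℕ}

/-! ## §1 Generic: a (CONV-C) family of unit-lattice kernels inhabits the covariance slot of the transfer model -/

/-- The weighted kernel `(p,q) ↦ C k p q · e^{δ₄|p−q|}` is bounded by `C₄` under (CONV-C)'s decay clause. [folklore] -/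
theorem weighted_le {C : ℕ → K d N → K d N → ℝ} {C₄ δ₄ θ : ℝ} (hC : ConvC C C₄ δ₄ θ) (k : ℕ)
    (pq : K d N × K d N) : ‖C k pq.1 pq.2 * Real.exp (δ₄ * dist pq.1.1 pq.2.1)‖ ≤ C₄ := by
  rw [Real.norm_eq_abs, abs_mul, abs_of_pos (Real.exp_pos _)]
  have h := hC.1 k pq.1 pq.2
  have hexp : 0 < Real.exp (δ₄ * dist pq.1.1 pq.2.1) := Real.exp_pos _
  calc |C k pq.1 pq.2| * Real.exp (δ₄ * dist pq.1.1 pq.2.1)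
      ≤ C₄ * Real.exp (-(δ₄ * dist pq.1.1 pq.2.1)) * Real.exp (δ₄ * dist pq.1.1 pq.2.1) :=
        mul_le_mul_of_nonneg_right h hexp.le
    _ = C₄ := by rw [mul_assoc, ← Real.exp_add, neg_add_cancel, Real.exp_zero, mul_one]

/-- The weighted one-step difference is bounded by `C₄θ^k` under (CONV-C)'s rate clause. [folklore] -/
theorem weighted_sub_le {C : ℕ → K d N → K d N → ℝ} {C₄ δ₄ θ : ℝ} (hC : ConvC C C₄ δ₄ θ) (k : ℕ)
    (pq : K d N × K d N) :
    ‖C (k + 1) pq.1 pq.2 * Real.exp (δ₄ * dist pq.1.1 pq.2.1) - C k pq.1 pq.2 * Real.exp (δ₄ * dist pq.1.1 pq.2.1)‖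
      ≤ C₄ * θ ^ k := by
  rw [← sub_mul, Real.norm_eq_abs, abs_mul, abs_of_pos (Real.exp_pos _)]
  have h := hC.2 k pq.1 pq.2
  have hexp : 0 < Real.exp (δ₄ * dist pq.1.1 pq.2.1) := Real.exp_pos _
  calc |C (k + 1) pq.1 pq.2 - C k pq.1 pq.2| * Real.exp (δ₄ * dist pq.1.1 pq.2.1)
      ≤ C₄ * θ ^ k * Real.exp (-(δ₄ * dist pq.1.1 pq.2.1)) * Real.exp (δ₄ * dist pq.1.1 pq.2.1) :=
        mul_le_mul_of_nonneg_right h hexp.le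
    _ = C₄ * θ ^ k := by rw [mul_assoc, ← Real.exp_add, neg_add_cancel, Real.exp_zero, mul_one]

/-- **THE COVARIANCE-SLOT MODEL FROM (CONV-C).**  For a family `C k` of unit-lattice kernels with `ConvC C C₄ δ₄ θ` (`C₄, θ ≥ 0`)
there is a one-step transfer model `M` on the Banach space of `e^{δ₄|p−q|}`-weighted bounded kernels whose stored bracket and new
bracket ARE the weighted `C k` (displayed), with NO history channel (`W = 0`) and NO β¹ read-out (`r = 0`), satisfying
`Represents`, L3 `TransferBound` (any `C_W, ω ≥ 0`), L4 `ActivityLipschitz`, L5 `CouplingLipschitz` (any nonnegative constants), L6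
`Admissible C₄`, and **L7 `StepScaleShift C₄ b_r θ E₀ γ`** (any `b_r ≥ 0`, any `E₀, γ`).  MODEL instance of the covariance slot
only — NOT O1. [folklore] -/
theorem model_of_convC {C : ℕ → K d N → K d N → ℝ} {C₄ δ₄ θ : ℝ} (hC : ConvC C C₄ δ₄ θ) (hC₄ : 0 ≤ C₄) (hθ : 0 ≤ θ) :
    ∃ M : StepTransferModel (K d N × K d N →ᵇ ℝ) (K d N × K d N →ᵇ ℝ),
      (∀ k c a pq, M.N k c a pq = C k pq.1 pq.2 * Real.exp (δ₄ * dist pq.1.1 pq.2.1)) ∧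
      (∀ k w pq, M.B k w pq = C k pq.1 pq.2 * Real.exp (δ₄ * dist pq.1.1 pq.2.1)) ∧
      (∀ k c, M.W k c = 0) ∧ (∀ k c a, M.r k c a = 0) ∧
      (∀ γ, M.Represents γ) ∧
      (∀ C_W ω γ : ℝ, 0 ≤ C_W → 0 ≤ ω → M.TransferBound C_W ω γ) ∧
      (∀ C_F C_r E₀ γ : ℝ, 0 ≤ C_F → 0 ≤ C_r → M.ActivityLipschitz C_F C_r E₀ γ) ∧
      (∀ ℓ' ℓ E₀ γ : ℝ, 0 ≤ ℓ' → 0 ≤ ℓ → M.CouplingLipschitz ℓ' ℓ E₀ γ) ∧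
      (∀ γ, M.Admissible C₄ γ) ∧
      (∀ b_r E₀ γ : ℝ, 0 ≤ b_r → M.StepScaleShift C₄ b_r θ E₀ γ) := by
  -- the weighted kernels as elements of the Banach space
  let wk : ℕ → (K d N × K d N →ᵇ ℝ) := fun k =>
    ofNormedAddCommGroupDiscrete (fun pq => C k pq.1 pq.2 * Real.exp (δ₄ * dist pq.1.1 pq.2.1)) C₄ (weighted_le hC k)
  have hwk : ∀ k pq, wk k pq = C k pq.1 pq.2 * Real.exp (δ₄ * dist pq.1.1 pq.2.1) := fun k pq => rfl
  have hnorm : ∀ k, ‖wk k‖ ≤ C₄ := fun k => (norm_le hC₄).2 (weighted_le hC k)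
  have hstep : ∀ k, ‖wk (k + 1) - wk k‖ ≤ C₄ * θ ^ k := fun k =>
    (norm_le (by positivity)).2 fun pq => by
      rw [BoundedContinuousFunction.sub_apply, hwk, hwk]
      exact weighted_sub_le hC k pq
  refine ⟨{ W := fun _ _ => 0, N := fun k _ _ => wk k, r := fun _ _ _ => 0, B := fun k _ => wk k },
    fun k c a pq => rfl, fun k w pq => rfl, fun k c => rfl, fun k c a => rfl, ?_, ?_, ?_, ?_, ?_, ?_⟩
  · -- Represents: both sides are `wk k`
    intro γ k g _
    rfl
  · -- TransferBound: `W = 0`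
    intro C_W ω γ hCW hω k c E _ _
    simp only [LinearMap.zero_apply, norm_zero]
    exact mul_nonneg hCW (Finset.sum_nonneg fun j _ => mul_nonneg (pow_nonneg hω _) (norm_nonneg _))
  · -- ActivityLipschitz: `N` ignores the activity, `r = 0`
    intro C_F C_r E₀ γ hCF hCr k c E E' _ _ _ _
    simp only [sub_self, norm_zero, abs_zero]
    exact ⟨mul_nonneg hCF (norm_nonneg _), mul_nonneg hCr (norm_nonneg _)⟩
  · -- CouplingLipschitz: `N`, `r` ignore the coupling
    intro ℓ' ℓ E₀ γ hℓ' hℓ k c c' E _ _ _ _ _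
    simp only [sub_self, norm_zero, abs_zero]
    exact ⟨mul_nonneg hℓ' (abs_nonneg _), mul_nonneg hℓ (abs_nonneg _)⟩
  · -- Admissible: (CONV-C)'s decay clause
    intro γ k g _
    exact hnorm k
  · -- StepScaleShift: (CONV-C)'s rate clause
    intro b_r E₀ γ hbr k c E _ _ _
    refine ⟨hstep k, ?_⟩
    simp only [sub_self, abs_zero]
    exact mul_nonneg hbr (pow_nonneg hθ _)

/-! ## §2 The Bałaban-typed instance: `C^{(k)}(𝟙)` on ℤ^{d+1} via `convC_balaban` ∕ `decayCauchy_balaban` -/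

/-- **BAŁABAN'S TYPED `U = 1` COVARIANCE FAMILY INHABITS THE COVARIANCE SLOT OF L7 WITH `ρ = L⁻²`.**  For `d ≥ 1`, `L ≥ 2` and
every `Λ ⊆ ℤ^{d+1}` there are explicit `C₄ ≥ 0`, `δ₄ > 0` (GAN24 road P2's `decayCauchy_balaban`) and a transfer model `M` on the
weighted kernel space whose brackets ARE the weighted `covPad (elimZ L) (deltaZ L) (IsFreeZ L) Λ k` (displayed) and which satisfies
`Represents`, L3–L6 and **`M.StepScaleShift C₄ b_r (L²)⁻¹ E₀ γ`**.  Covariance slot only (`W = 0`, `r = 0`); NOT O1, NOT NE4, NOT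
NE7. [folklore] -/
theorem model_balabanCov (hd : 1 ≤ d) (L : ℕ) [NeZero L] (hL : 2 ≤ L) (Λ : Set (Fin (d + 1) → ℤ)) :
    ∃ (C₄ δ₄ : ℝ) (M : StepTransferModel (K (d + 1) (d + 1) × K (d + 1) (d + 1) →ᵇ ℝ)
        (K (d + 1) (d + 1) × K (d + 1) (d + 1) →ᵇ ℝ)),
      0 ≤ C₄ ∧ 0 < δ₄ ∧
      (∀ k c a pq, M.N k c a pq =
        covPad (elimZ L) (deltaZ L) (IsFreeZ L) Λ k pq.1 pq.2 * Real.exp (δ₄ * dist pq.1.1 pq.2.1)) ∧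
      (∀ k w pq, M.B k w pq =
        covPad (elimZ L) (deltaZ L) (IsFreeZ L) Λ k pq.1 pq.2 * Real.exp (δ₄ * dist pq.1.1 pq.2.1)) ∧
      (∀ k c, M.W k c = 0) ∧ (∀ k c a, M.r k c a = 0) ∧
      (∀ γ, M.Represents γ) ∧
      (∀ C_W ω γ : ℝ, 0 ≤ C_W → 0 ≤ ω → M.TransferBound C_W ω γ) ∧
      (∀ C_F C_r E₀ γ : ℝ, 0 ≤ C_F → 0 ≤ C_r → M.ActivityLipschitz C_F C_r E₀ γ) ∧
      (∀ ℓ' ℓ E₀ γ : ℝ, 0 ≤ ℓ' → 0 ≤ ℓ → M.CouplingLipschitz ℓ' ℓ E₀ γ) ∧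
      (∀ γ, M.Admissible C₄ γ) ∧
      (∀ b_r E₀ γ : ℝ, 0 ≤ b_r → M.StepScaleShift C₄ b_r (((L : ℝ) ^ 2)⁻¹) E₀ γ) := by
  obtain ⟨C₄, δ₄, hC₄, hδ₄, hconv, _⟩ := decayCauchy_balaban hd L hL Λ
  obtain ⟨M, hN, hB, hW, hr, hRep, hT, hA, hCL, hAdm, hS⟩ := model_of_convC hconv hC₄ (by positivity)
  exact ⟨C₄, δ₄, M, hC₄, hδ₄, hN, hB, hW, hr, hRep, hT, hA, hCL, hAdm, hS⟩

/-! ## §3 The case of the cell: `d + 1 = 4` -/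

/-- The four-dimensional case (`d = 3`): on ℤ⁴ Bałaban's typed `C^{(k)}(𝟙)` family inhabits the covariance slot of L7 with
`ρ = L⁻²` for every block size `L ≥ 2` and every region `Λ`.  Slot model only; NOT O1, NOT NE4, NOT NE7. [folklore] -/
theorem model_balabanCov_dim4 (L : ℕ) [NeZero L] (hL : 2 ≤ L) (Λ : Set (Fin 4 → ℤ)) :
    ∃ (C₄ δ₄ : ℝ) (M : StepTransferModel (K 4 4 × K 4 4 →ᵇ ℝ) (K 4 4 × K 4 4 →ᵇ ℝ)),
      0 ≤ C₄ ∧ 0 < δ₄ ∧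
      (∀ k c a pq, M.N k c a pq =
        covPad (elimZ L) (deltaZ L) (IsFreeZ L) Λ k pq.1 pq.2 * Real.exp (δ₄ * dist pq.1.1 pq.2.1)) ∧
      (∀ γ, M.Represents γ) ∧ (∀ γ, M.Admissible C₄ γ) ∧
      (∀ b_r E₀ γ : ℝ, 0 ≤ b_r → M.StepScaleShift C₄ b_r (((L : ℝ) ^ 2)⁻¹) E₀ γ) := by
  obtain ⟨C₄, δ₄, M, hC₄, hδ₄, hN, _, _, _, hRep, _, _, _, hAdm, hS⟩ :=
    model_balabanCov (d := 3) (by norm_num) L hL Λ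
  exact ⟨C₄, δ₄, M, hC₄, hδ₄, hN, hRep, hAdm, hS⟩

end Summit.QuantumFields.BalabanUV.T4Continuum.NE7EtaCovarianceSlot

end
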